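import Mathlib.Analysis.SpecialFunctions.Pow.Real
import Mathlib.Analysis.SpecialFunctions.Pow.Continuity
import Mathlib.Analysis.SpecialFunctions.Pow.Asymptotics
import Mathlib.Topology.Algebra.InfiniteSum.Real
import Mathlib.Analysis.SpecialFunctions.Gamma.Basic
import Mathlib.Analysis.SpecialFunctions.Gaussian.GaussianIntegral
import Mathlib.MeasureTheory.Integral.IntegralEqImproper
import Mathlib.MeasureTheory.Integral.IntervalIntegral.FundThmCalculus
import Literature.NumberTheory.LFunctions.ZetaLogDerivTaylorPrimes
import Literature.NumberTheory.LFunctions.LiCoefficientArithmeticFormula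
import Literature.NumberTheory.LFunctions.KeiperLiTrend
import Literature.NumberTheory.LFunctions.BombieriLagariasEtaLimit
import HarnessLib

/-!
# RH-FREE: the arithmetic formula for Li's coefficients — identification of the `η_k` and `Coffey2005_thm1`

Topic `Literature/NumberTheory/LFunctions`.  This file DISCHARGES the named fact `Coffey2005_thm1` of
`LiCoefficientArithmeticFormula.lean` (Coffey 2005, Thm. 1 = Bombieri–Lagarias 1999, Thm. 2, the ARITHMETIC
FORMULA): (i) the limits `η_k = ((−1)^k/k!) lim_N (Σ_{m≤N} Λ(m)(log m)^k/m − (log N)^{k+1}/(k+1))` exist, and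
(ii) `λ_n = λ̄_n + λ̃_n` (`keiperLiCoeff n = liTrend n + liOscPart n`) for `n ≥ 1`.  Everything is PROVED; no
definitions; **RH-FREE** (no hypothesis on the zeros of `ζ`).

Ingredients already in the tree: the existence of the limits (`BombieriLagariasEtaLimit.lean`, from
`ψ(x) − x = O(x/(log x)^A)`), the Abelian form `Σ_n Λ(n)(log n)^k n^{−s} − k!/(s−1)^{k+1} → (−1)^{k+1} k!·q_k`
(`ZetaLogDerivTaylorPrimes.lean`, `q_k = (ζ₁'/ζ₁)^{(k)}(1)/k!`), and the trend/oscillation split in `q`-form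
(`KeiperLiTrend.keiperLiCoeff_sub_osc_eq_finite_sum`).  New here:

* `tendsto_liEtaSeq` — **identification**: `liEtaSeq k N → (−1)^{k+1} k!·Re q_k`.  Proof: Abel summation
  writes the Dirichlet series `D(u) = Σ_m Λ(m)(log m)^k m^{−1−u}` (`u > 0`) as `Σ_N w_N(u) A(N+1)` with the
  kernel `w_N(u) = (N+1)^{−u} − (N+2)^{−u} ≥ 0`, `Σ_N w_N(u) = 1`, and `A = F + G`, `F(N) = (log N)^{k+1}/(k+1)`,
  `G = liEtaSeq k → L`; the kernel is a regular (Toeplitz) summation method as `u → 0⁺`, so `Σ w G(N+1) → L`,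
  while `Σ_N w_N(u)F(N+1)` is squeezed against the Gamma integral `∫_0^∞ (τ^{k+1}/(k+1)) u e^{−uτ}dτ = k!/u^{k+1}`
  (pieces over `[log(N+1), log(N+2)]`) with an error `≤ Σ w (F(N+2) − F(N+1)) → 0`; hence
  `D(u) − k!/u^{k+1} → L`, and `D(u) = Re L((log)^kΛ)(1+u)` identifies `L` by uniqueness of limits.
* `liEta_eq_neg_re_zetaOneLogDerivCoeff` — `η_k = −Re q_k` (the sign dictionary of the column LI);
* `liOscPart_eq_sum_zetaOneLogDerivCoeff` — `λ̃_n = Σ_{j<n} C(n,j+1) Re q_j`;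
* `Coffey2005_thm1_holds` — the discharge.

## References

* M. W. Coffey, Math. Phys. Anal. Geom. 8 (2005) 211–255, Thm. 1, eqs. (10)–(12), (52). [Coffey2005LiCriterion]
* E. Bombieri, J. C. Lagarias, J. Number Theory 77 (1999) 274–287, Thm. 2. [BombieriLagarias1999]
* M. W. Coffey, Analysis 30 (2010) 383–409, eq. (5) (held: `paper:arxiv-0706.0343`). [Coffey2010Eta]
-/

noncomputable section

open Filter Topology Finset

namespace Literature.NumberTheory.LFunctions

/-- The Abel kernel `w_N(u) = (N+1)^{−u} − (N+2)^{−u}`. [folklore] -/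
private theorem kernel_nonneg {u : ℝ} (hu : 0 ≤ u) (N : ℕ) :
    0 ≤ ((N : ℝ) + 1) ^ (-u) - ((N : ℝ) + 2) ^ (-u) := by
  rw [Real.rpow_neg (by positivity), Real.rpow_neg (by positivity), sub_nonneg]
  exact inv_anti₀ (Real.rpow_pos_of_pos (by positivity) _)
    (Real.rpow_le_rpow (by positivity) (by linarith) hu)

/-- Partial sums of the kernel telescope: `Σ_{N<M} w_N(u) = 1 − (M+1)^{−u}`. [folklore] -/
private theorem sum_kernel (u : ℝ) (M : ℕ) :
    ∑ N ∈ Finset.range M, (((N : ℝ) + 1) ^ (-u) - ((N : ℝ) + 2) ^ (-u)) = 1 - ((M : ℝ) + 1) ^ (-u) := by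
  induction M with
  | zero => simp
  | succ M ih =>
    rw [Finset.sum_range_succ, ih]
    push_cast
    ring

/-- The kernel sums to `1` for `u > 0`. [folklore] -/
private theorem hasSum_kernel {u : ℝ} (hu : 0 < u) :
    HasSum (fun N : ℕ ↦ ((N : ℝ) + 1) ^ (-u) - ((N : ℝ) + 2) ^ (-u)) 1 := by
  rw [hasSum_iff_tendsto_nat_of_nonneg (kernel_nonneg hu.le)]
  simp_rw [sum_kernel]
  have h : Tendsto (fun M : ℕ ↦ ((M : ℝ) + 1) ^ (-u)) atTop (𝓝 0) := by
    have h1 : Tendsto (fun x : ℝ ↦ x ^ (-u)) atTop (𝓝 0) := tendsto_rpow_neg_atTop hu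
    have h2 : Tendsto (fun M : ℕ ↦ (M : ℝ) + 1) atTop atTop :=
      tendsto_atTop_add_const_right _ 1 tendsto_natCast_atTop_atTop
    exact h1.comp h2
  simpa using (tendsto_const_nhds (x := (1 : ℝ))).sub h

/-- **Abelian step (Toeplitz for the kernel `w_N(u)`)**: if `G(N) → L` then
`Σ_N G(N+1) w_N(u) → L` as `u → 0⁺`. [folklore] -/
private theorem tendsto_tsum_kernel_mul {G : ℕ → ℝ} {L : ℝ} (hG : Tendsto G atTop (𝓝 L)) :
    Tendsto (fun u : ℝ ↦ ∑' N : ℕ, (((N : ℝ) + 1) ^ (-u) - ((N : ℝ) + 2) ^ (-u)) * G (N + 1))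
      (𝓝[>] 0) (𝓝 L) := by
  -- `G` is bounded
  obtain ⟨B, hB⟩ : ∃ B, ∀ N, |G N - L| ≤ B := by
    obtain ⟨B, hBev⟩ : ∃ b, ∀ᶠ N in atTop, |G N - L| ≤ b := ((hG.sub_const L).abs).isBoundedUnder_le
    obtain ⟨N₀, hN₀⟩ := Filter.eventually_atTop.1 hBev
    refine ⟨max B (Finset.sup' (Finset.range (N₀ + 1)) ⟨0, by simp⟩ fun N ↦ |G N - L|), fun N ↦ ?_⟩
    rcases le_or_gt N₀ N with h | h
    · exact (hN₀ N h).trans (le_max_left _ _)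
    · refine le_trans ?_ (le_max_right _ _)
      exact Finset.le_sup' (fun N ↦ |G N - L|) (Finset.mem_range.2 (by omega))
  have hB0 : 0 ≤ B := (abs_nonneg _).trans (hB 0)
  rw [Metric.tendsto_nhdsWithin_nhds]
  intro ε hε
  -- `N₀` with `|G(N+1) − L| ≤ ε/2` for `N ≥ N₀`
  have hε2 : 0 < ε / 2 := by linarith
  obtain ⟨N₀, hN₀⟩ := Filter.eventually_atTop.1 (Metric.tendsto_nhds.1 hG (ε / 2) hε2)
  -- `δ` with `(B+1)(1 − (N₀+1)^{−u}) < ε/2` for `0 < u < δ`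
  have hcont : ContinuousAt (fun u : ℝ ↦ (B + 1) * (1 - ((N₀ : ℝ) + 1) ^ (-u))) 0 := by
    have : ContinuousAt (fun u : ℝ ↦ ((N₀ : ℝ) + 1) ^ (-u)) 0 :=
      ContinuousAt.rpow continuousAt_const (continuousAt_neg) (Or.inl (by positivity))
    exact continuousAt_const.mul (continuousAt_const.sub this)
  obtain ⟨δ, hδ, hδε⟩ := Metric.continuousAt_iff.1 hcont (ε / 2) hε2
  refine ⟨δ, hδ, fun u hu hdist ↦ ?_⟩
  have hu : 0 < u := hu
  have hsmall : (B + 1) * (1 - ((N₀ : ℝ) + 1) ^ (-u)) < ε / 2 := by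
    have := hδε hdist
    rw [neg_zero, Real.rpow_zero, sub_self, mul_zero, Real.dist_eq, sub_zero] at this
    exact lt_of_abs_lt this
  -- summability
  set w : ℕ → ℝ := fun N ↦ ((N : ℝ) + 1) ^ (-u) - ((N : ℝ) + 2) ^ (-u) with hw
  have hwsum : HasSum w 1 := hasSum_kernel hu
  have hw0 : ∀ N, 0 ≤ w N := kernel_nonneg hu.le
  have hsumm : Summable fun N ↦ w N * (G (N + 1) - L) := by
    refine Summable.of_norm_bounded (g := fun N ↦ B * w N) (hwsum.summable.mul_left B) fun N ↦ ?_
    rw [Real.norm_eq_abs, abs_mul, abs_of_nonneg (hw0 N), mul_comm]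
    exact mul_le_mul_of_nonneg_right (hB _) (hw0 N)
  have hsplit : ∑' N, w N * G (N + 1) = L + ∑' N, w N * (G (N + 1) - L) := by
    have h1 : ∑' N, w N * G (N + 1) = ∑' N, (w N * (G (N + 1) - L) + L * w N) := by
      congr 1; funext N; ring
    rw [h1, (hsumm.hasSum.add (hwsum.mul_left L)).tsum_eq]
    ring
  rw [Real.dist_eq, hsplit, add_sub_cancel_left]
  -- split the error sum at `N₀`
  have htail : ∑' N, w N * (G (N + 1) - L) =
      ∑ N ∈ Finset.range N₀, w N * (G (N + 1) - L) + ∑' N, w (N + N₀) * (G (N + N₀ + 1) - L) := by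
    rw [← Summable.sum_add_tsum_nat_add N₀ hsumm]
  rw [htail]
  have h1 : |∑ N ∈ Finset.range N₀, w N * (G (N + 1) - L)| ≤ B * (1 - ((N₀ : ℝ) + 1) ^ (-u)) := by
    calc |∑ N ∈ Finset.range N₀, w N * (G (N + 1) - L)|
        ≤ ∑ N ∈ Finset.range N₀, |w N * (G (N + 1) - L)| := Finset.abs_sum_le_sum_abs _ _
      _ ≤ ∑ N ∈ Finset.range N₀, w N * B := Finset.sum_le_sum fun N _ ↦ by
          rw [abs_mul, abs_of_nonneg (hw0 N)]
          exact mul_le_mul_of_nonneg_left (hB _) (hw0 N)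
      _ = B * (1 - ((N₀ : ℝ) + 1) ^ (-u)) := by
          rw [← Finset.sum_mul, mul_comm, hw, sum_kernel]
  have h2 : |∑' N, w (N + N₀) * (G (N + N₀ + 1) - L)| ≤ ε / 2 := by
    have hs2 : Summable fun N ↦ w (N + N₀) * (G (N + N₀ + 1) - L) :=
      (summable_nat_add_iff N₀).2 hsumm
    have hws : Summable fun N ↦ w (N + N₀) := (summable_nat_add_iff N₀).2 hwsum.summable
    calc |∑' N, w (N + N₀) * (G (N + N₀ + 1) - L)|
        ≤ ∑' N, |w (N + N₀) * (G (N + N₀ + 1) - L)| := by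
          have hn : Summable fun N ↦ ‖w (N + N₀) * (G (N + N₀ + 1) - L)‖ := by
            simpa only [Real.norm_eq_abs] using Summable.abs hs2
          have h := norm_tsum_le_tsum_norm hn
          simpa only [Real.norm_eq_abs] using h
      _ ≤ ∑' N, w (N + N₀) * (ε / 2) := by
          refine Summable.tsum_le_tsum (fun N ↦ ?_) (Summable.abs hs2) (hws.mul_right (ε / 2))
          rw [abs_mul, abs_of_nonneg (hw0 _)]
          refine mul_le_mul_of_nonneg_left ?_ (hw0 _)
          have := hN₀ (N + N₀ + 1) (by omega)
          rw [Real.dist_eq] at this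
          exact this.le
      _ = (∑' N, w (N + N₀)) * (ε / 2) := by rw [tsum_mul_right]
      _ ≤ 1 * (ε / 2) := by
          refine mul_le_mul_of_nonneg_right ?_ hε2.le
          have hst := Summable.sum_add_tsum_nat_add N₀ hwsum.summable
          rw [hwsum.tsum_eq, hw, sum_kernel] at hst
          have hle : ((N₀ : ℝ) + 1) ^ (-u) ≤ 1 :=
            Real.rpow_le_one_of_one_le_of_nonpos (by linarith) (by linarith)
          linarith
      _ = ε / 2 := one_mul _
  calc |∑ N ∈ Finset.range N₀, w N * (G (N + 1) - L) + ∑' N, w (N + N₀) * (G (N + N₀ + 1) - L)|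
      ≤ |∑ N ∈ Finset.range N₀, w N * (G (N + 1) - L)| + |∑' N, w (N + N₀) * (G (N + N₀ + 1) - L)| :=
        abs_add_le _ _
    _ ≤ B * (1 - ((N₀ : ℝ) + 1) ^ (-u)) + ε / 2 := add_le_add h1 h2
    _ < ε := by
        have : 0 ≤ 1 - ((N₀ : ℝ) + 1) ^ (-u) := by
          have := sum_kernel u N₀ ▸ Finset.sum_nonneg fun N _ ↦ hw0 N
          simpa [hw] using this
        nlinarith

/-- `(log(M+1) + 1)^p · (M+1)^{−u} → 0`. [folklore] -/
private theorem tendsto_logpow_mul_rpow_neg (p : ℕ) {u : ℝ} (hu : 0 < u) :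
    Tendsto (fun M : ℕ ↦ (Real.log ((M : ℝ) + 1) + 1) ^ p * ((M : ℝ) + 1) ^ (-u)) atTop (𝓝 0) := by
  -- `(log x + 1)^p x^{-u} = ((log x + 1) / x^{u/p'})^p`-type argument via `log x = o(x^r)`
  have h1 : Tendsto (fun x : ℝ ↦ (Real.log x + 1) / x ^ (u / (p + 1))) atTop (𝓝 0) := by
    have hr : 0 < u / (p + 1) := by positivity
    have hlog : Tendsto (fun x : ℝ ↦ Real.log x / x ^ (u / (p + 1))) atTop (𝓝 0) :=
      (isLittleO_log_rpow_atTop hr).tendsto_div_nhds_zero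
    have hone : Tendsto (fun x : ℝ ↦ 1 / x ^ (u / (p + 1))) atTop (𝓝 0) := by
      have := tendsto_rpow_neg_atTop hr
      refine this.congr' ?_
      filter_upwards [Filter.eventually_gt_atTop 0] with x hx
      rw [Real.rpow_neg hx.le, one_div]
    simpa [add_div] using hlog.add hone
  -- raise to the power `p+1` ... we only need: (log x + 1)^p * x^{-u} ≤ ((log x + 1)/x^{u/(p+1)})^{p+1} when log x + 1 ≥ 1
  have h2 : Tendsto (fun x : ℝ ↦ ((Real.log x + 1) / x ^ (u / (p + 1))) ^ (p + 1)) atTop (𝓝 0) := by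
    simpa using h1.pow (p + 1)
  have h3 : Tendsto (fun M : ℕ ↦ ((Real.log ((M : ℝ) + 1) + 1) / ((M : ℝ) + 1) ^ (u / (p + 1))) ^ (p + 1))
      atTop (𝓝 0) :=
    h2.comp (tendsto_atTop_add_const_right _ 1 tendsto_natCast_atTop_atTop)
  refine squeeze_zero_norm' ?_ h3
  filter_upwards [Filter.eventually_ge_atTop 2] with M hM
  have hM1 : (1 : ℝ) ≤ (M : ℝ) + 1 := by have := M.cast_nonneg (α := ℝ); linarith
  have hx0 : (0 : ℝ) < (M : ℝ) + 1 := by linarith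
  have hlog1 : 1 ≤ Real.log ((M : ℝ) + 1) + 1 := by linarith [Real.log_nonneg hM1]
  rw [Real.norm_eq_abs, abs_of_nonneg (by positivity), div_pow,
    ← Real.rpow_natCast (((M : ℝ) + 1) ^ (u / (p + 1))) (p + 1), ← Real.rpow_mul hx0.le]
  have e : u / ((p : ℝ) + 1) * ((p + 1 : ℕ) : ℝ) = u := by push_cast; field_simp
  rw [e, Real.rpow_neg hx0.le, ← div_eq_mul_inv]
  apply div_le_div_of_nonneg_right _ (by positivity)
  rw [pow_succ]
  exact le_mul_of_one_le_right (by positivity) hlog1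

/-- **Abel summation for a Dirichlet series with non-negative coefficients**: for `u > 0`, `a_m ≥ 0`
(term `m` sits at the integer `m+1`) with `Σ_{m<N} a_m ≤ C (log(N+1)+1)^p` and `Σ a_m (m+1)^{−u}`
summable: `Σ_m a_m (m+1)^{−u} = Σ_N ((N+1)^{−u} − (N+2)^{−u}) · Σ_{m ≤ N} a_m`. [folklore] -/
private theorem hasSum_kernel_mul_partialSum {u : ℝ} (hu : 0 < u) {a : ℕ → ℝ} (ha : ∀ m, 0 ≤ a m)
    {C : ℝ} {p : ℕ} (hA : ∀ N : ℕ, ∑ m ∈ Finset.range N, a m ≤ C * (Real.log ((N : ℝ) + 1) + 1) ^ p)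
    (hS : Summable fun m : ℕ ↦ a m * ((m : ℝ) + 1) ^ (-u)) :
    HasSum (fun N : ℕ ↦ (((N : ℝ) + 1) ^ (-u) - ((N : ℝ) + 2) ^ (-u)) * ∑ m ∈ Finset.range (N + 1), a m)
      (∑' m : ℕ, a m * ((m : ℝ) + 1) ^ (-u)) := by
  set f : ℕ → ℝ := fun m ↦ ((m : ℝ) + 1) ^ (-u) with hf
  set A : ℕ → ℝ := fun N ↦ ∑ m ∈ Finset.range N, a m with hAdef
  -- finite Abel summation
  have hparts : ∀ M : ℕ, ∑ m ∈ Finset.range M, a m * f m =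
      f (M - 1) * A M - ∑ m ∈ Finset.range (M - 1), (f (m + 1) - f m) * A (m + 1) := by
    intro M
    have h := Finset.sum_range_by_parts f a M
    simp only [smul_eq_mul] at h
    rw [show ∑ m ∈ Finset.range M, a m * f m = ∑ m ∈ Finset.range M, f m * a m by
      refine Finset.sum_congr rfl fun m _ ↦ mul_comm _ _]
    exact h
  -- the boundary term tends to `0`
  have hC0 : 0 ≤ C := by
    have := hA 0
    simp at this
    exact this
  have hbd : Tendsto (fun M : ℕ ↦ f (M - 1) * A M) atTop (𝓝 0) := by
    have hz := (tendsto_logpow_mul_rpow_neg p hu).const_mul (2 ^ u * C)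
    rw [mul_zero] at hz
    refine squeeze_zero_norm' ?_ hz
    filter_upwards [Filter.eventually_ge_atTop 1] with M hM
    have hcast : (((M - 1 : ℕ) : ℝ) + 1) = M := by rw [Nat.cast_sub hM]; push_cast; ring
    have hMpos : (0 : ℝ) < M := by exact_mod_cast hM
    have hA0 : 0 ≤ A M := Finset.sum_nonneg fun m _ ↦ ha m
    have hfM : f (M - 1) = (M : ℝ) ^ (-u) := by simp only [hf]; rw [hcast]
    rw [Real.norm_eq_abs, hfM, abs_of_nonneg (mul_nonneg (by positivity) hA0)]
    -- `M^{-u} ≤ 2^u (M+1)^{-u}`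
    have hcmp : (M : ℝ) ^ (-u) ≤ 2 ^ u * ((M : ℝ) + 1) ^ (-u) := by
      rw [Real.rpow_neg hMpos.le, Real.rpow_neg (by positivity), ← Real.inv_rpow hMpos.le,
        ← Real.inv_rpow (by positivity), ← Real.mul_rpow (by positivity) (by positivity)]
      apply Real.rpow_le_rpow (by positivity) _ hu.le
      have : (1 : ℝ) ≤ M := by exact_mod_cast hM
      rw [inv_le_iff_one_le_mul₀ hMpos]
      field_simp
      linarith
    have h1 := hA M
    calc (M : ℝ) ^ (-u) * A M ≤ (2 ^ u * ((M : ℝ) + 1) ^ (-u)) * (C * (Real.log ((M : ℝ) + 1) + 1) ^ p) :=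
          mul_le_mul hcmp h1 hA0 (by positivity)
      _ = 2 ^ u * C * ((Real.log ((M : ℝ) + 1) + 1) ^ p * ((M : ℝ) + 1) ^ (-u)) := by ring
  -- partial sums of the kernel series
  have hw : ∀ N : ℕ, ((N : ℝ) + 1) ^ (-u) - ((N : ℝ) + 2) ^ (-u) = -(f (N + 1) - f N) := by
    intro N; simp only [hf]; push_cast; ring
  have hpartial : ∀ K : ℕ, ∑ N ∈ Finset.range K, (((N : ℝ) + 1) ^ (-u) - ((N : ℝ) + 2) ^ (-u)) * A (N + 1) =
      ∑ m ∈ Finset.range (K + 1), a m * f m - f K * A (K + 1) := by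
    intro K
    rw [hparts (K + 1), Nat.add_sub_cancel]
    simp only [hw, neg_mul, Finset.sum_neg_distrib]
    ring
  have hnonneg : ∀ N : ℕ, 0 ≤ (((N : ℝ) + 1) ^ (-u) - ((N : ℝ) + 2) ^ (-u)) * A (N + 1) := fun N ↦
    mul_nonneg (kernel_nonneg hu.le N) (Finset.sum_nonneg fun m _ ↦ ha m)
  rw [hasSum_iff_tendsto_nat_of_nonneg hnonneg]
  have hlim : Tendsto (fun K : ℕ ↦ ∑ m ∈ Finset.range (K + 1), a m * f m - f K * A (K + 1)) atTop
      (𝓝 (∑' m, a m * f m - 0)) :=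
    (hS.hasSum.tendsto_sum_nat.comp (tendsto_add_atTop_nat 1)).sub
      ((hbd.comp (tendsto_add_atTop_nat 1)).congr fun K ↦ by
        simp only [Function.comp, Nat.add_sub_cancel])
  rw [sub_zero] at hlim
  exact hlim.congr fun K ↦ (hpartial K).symm

/-! ### Step (III): the main term `Σ_N w_N(u) F(N+1)` versus `k!/u^{k+1}` -/

/-- The kernel as an integral: `∫_{t_N}^{t_{N+1}} u e^{−uτ} dτ = (N+1)^{−u} − (N+2)^{−u}`,
`t_N = log(N+1)`. [folklore] -/
private theorem integral_kernel (u : ℝ) (N : ℕ) :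
    ∫ τ in Real.log ((N : ℝ) + 1)..Real.log ((N : ℝ) + 2), u * Real.exp (-(u * τ)) =
      ((N : ℝ) + 1) ^ (-u) - ((N : ℝ) + 2) ^ (-u) := by
  have hderiv : ∀ τ ∈ Set.uIcc (Real.log ((N : ℝ) + 1)) (Real.log ((N : ℝ) + 2)),
      HasDerivAt (fun τ : ℝ ↦ -Real.exp (-(u * τ))) (u * Real.exp (-(u * τ))) τ := by
    intro τ _
    have h1 : HasDerivAt (fun τ : ℝ ↦ -(u * τ)) (-(u * 1)) τ := ((hasDerivAt_id τ).const_mul u).neg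
    have h2 := h1.exp.neg
    refine h2.congr_deriv ?_
    ring
  rw [intervalIntegral.integral_eq_sub_of_hasDerivAt hderiv
    ((by fun_prop : Continuous fun τ : ℝ ↦ u * Real.exp (-(u * τ))).intervalIntegrable _ _)]
  rw [Real.rpow_def_of_pos (by positivity), Real.rpow_def_of_pos (by positivity)]
  ring_nf

/-- The pieces `∫_{t_N}^{t_{N+1}} (τ^{k+1}/(k+1)) u e^{−uτ} dτ` are squeezed between
`F(N+1) w_N(u)` and `F(N+2) w_N(u)`, `F(M) = (log M)^{k+1}/(k+1)`. [folklore] -/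
private theorem piece_bounds (k : ℕ) {u : ℝ} (hu : 0 < u) (N : ℕ) :
    Real.log ((N : ℝ) + 1) ^ (k + 1) / ((k : ℝ) + 1) * (((N : ℝ) + 1) ^ (-u) - ((N : ℝ) + 2) ^ (-u)) ≤
      ∫ τ in Real.log ((N : ℝ) + 1)..Real.log ((N : ℝ) + 2),
        τ ^ (k + 1) / ((k : ℝ) + 1) * (u * Real.exp (-(u * τ))) ∧
    ∫ τ in Real.log ((N : ℝ) + 1)..Real.log ((N : ℝ) + 2),
        τ ^ (k + 1) / ((k : ℝ) + 1) * (u * Real.exp (-(u * τ))) ≤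
      Real.log ((N : ℝ) + 2) ^ (k + 1) / ((k : ℝ) + 1) * (((N : ℝ) + 1) ^ (-u) - ((N : ℝ) + 2) ^ (-u)) := by
  set t₀ := Real.log ((N : ℝ) + 1) with ht₀
  set t₁ := Real.log ((N : ℝ) + 2) with ht₁
  have h01 : t₀ ≤ t₁ := Real.log_le_log (by positivity) (by linarith)
  have ht0 : 0 ≤ t₀ := Real.log_nonneg (by have := N.cast_nonneg (α := ℝ); linarith)
  have hcont : Continuous fun τ : ℝ ↦ τ ^ (k + 1) / ((k : ℝ) + 1) * (u * Real.exp (-(u * τ))) := by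
    fun_prop
  have hker : Continuous fun τ : ℝ ↦ u * Real.exp (-(u * τ)) := by fun_prop
  rw [← integral_kernel u N, ← ht₀, ← ht₁, ← intervalIntegral.integral_const_mul,
    ← intervalIntegral.integral_const_mul]
  constructor
  · refine intervalIntegral.integral_mono_on h01 ((hker.const_mul _).intervalIntegrable _ _)
      (hcont.intervalIntegrable _ _) fun τ hτ ↦ ?_
    have hτ0 : 0 ≤ τ := ht0.trans hτ.1
    exact mul_le_mul_of_nonneg_right (div_le_div_of_nonneg_right (pow_le_pow_left₀ ht0 hτ.1 _) (by positivity))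
      (by positivity)
  · refine intervalIntegral.integral_mono_on h01 (hcont.intervalIntegrable _ _)
      ((hker.const_mul _).intervalIntegrable _ _) fun τ hτ ↦ ?_
    have hτ0 : 0 ≤ τ := ht0.trans hτ.1
    exact mul_le_mul_of_nonneg_right (div_le_div_of_nonneg_right (pow_le_pow_left₀ hτ0 hτ.2 _) (by positivity))
      (by positivity)

/-- The pieces sum to the Gamma integral: `Σ_N ∫_{t_N}^{t_{N+1}} (τ^{k+1}/(k+1)) u e^{−uτ} dτ = k!/u^{k+1}`. [folklore] -/
private theorem hasSum_pieces (k : ℕ) {u : ℝ} (hu : 0 < u) :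
    HasSum (fun N : ℕ ↦ ∫ τ in Real.log ((N : ℝ) + 1)..Real.log ((N : ℝ) + 2),
        τ ^ (k + 1) / ((k : ℝ) + 1) * (u * Real.exp (-(u * τ))))
      ((k.factorial : ℝ) / u ^ (k + 1)) := by
  set h : ℝ → ℝ := fun τ ↦ τ ^ (k + 1) / ((k : ℝ) + 1) * (u * Real.exp (-(u * τ))) with hh
  set t : ℕ → ℝ := fun N ↦ Real.log ((N : ℝ) + 1) with ht
  have ht_succ : ∀ N : ℕ, Real.log ((N : ℝ) + 2) = t (N + 1) := fun N ↦ by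
    simp only [ht]; push_cast; ring_nf
  have hcont : Continuous h := by simp only [hh]; fun_prop
  -- nonnegativity of the pieces
  have hnonneg : ∀ N, 0 ≤ ∫ τ in t N..t (N + 1), h τ := by
    intro N
    refine intervalIntegral.integral_nonneg (Real.log_le_log (by positivity) (by push_cast; linarith)) fun τ hτ ↦ ?_
    have : 0 ≤ τ := (Real.log_nonneg (by have := N.cast_nonneg (α := ℝ); linarith)).trans hτ.1
    simp only [hh]; positivity
  -- integrability on `(0, ∞)` and the value of the improper integral
  have hint : MeasureTheory.IntegrableOn h (Set.Ioi 0) := by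
    have h1 := integrableOn_rpow_mul_exp_neg_mul_rpow (s := (k + 1 : ℕ)) (p := 1) (b := u)
      (by have := (k + 1).cast_nonneg (α := ℝ); push_cast at this ⊢; linarith) le_rfl hu
    have h2 : MeasureTheory.IntegrableOn
        (fun x : ℝ ↦ u / ((k : ℝ) + 1) * (x ^ ((k + 1 : ℕ) : ℝ) * Real.exp (-u * x ^ (1 : ℝ)))) (Set.Ioi 0) :=
      h1.const_mul (u / ((k : ℝ) + 1))
    refine MeasureTheory.IntegrableOn.congr_fun h2 (fun τ hτ ↦ ?_) measurableSet_Ioi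
    simp only [hh, Real.rpow_natCast, Real.rpow_one]
    ring_nf
  have hval : ∫ τ in Set.Ioi 0, h τ = (k.factorial : ℝ) / u ^ (k + 1) := by
    have hG := Real.integral_rpow_mul_exp_neg_mul_Ioi (a := (k : ℝ) + 2) (r := u) (by positivity) hu
    have e : ∀ τ : ℝ, τ ∈ Set.Ioi (0 : ℝ) →
        h τ = u / ((k : ℝ) + 1) * (τ ^ ((k : ℝ) + 2 - 1) * Real.exp (-(u * τ))) := by
      intro τ hτ
      simp only [hh]
      rw [show (k : ℝ) + 2 - 1 = ((k + 1 : ℕ) : ℝ) by push_cast; ring, Real.rpow_natCast]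
      ring
    rw [MeasureTheory.setIntegral_congr_fun measurableSet_Ioi e, MeasureTheory.integral_const_mul, hG,
      show (k : ℝ) + 2 = ((k + 1 : ℕ) : ℝ) + 1 by push_cast; ring, Real.Gamma_nat_eq_factorial,
      show ((k + 1 : ℕ) : ℝ) + 1 = ((k + 2 : ℕ) : ℝ) by push_cast; ring, Real.rpow_natCast,
      Nat.factorial_succ]
    push_cast
    have hu0 : u ≠ 0 := hu.ne'
    have hk : ((k : ℝ) + 1) ≠ 0 := by positivity
    rw [one_div, inv_pow]
    field_simp
    ring
  -- partial sums = integral up to `t M`, which tends to the improper integral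
  have hpartial : ∀ M : ℕ, ∑ N ∈ Finset.range M, ∫ τ in t N..t (N + 1), h τ = ∫ τ in (0 : ℝ)..t M, h τ := by
    intro M
    rw [intervalIntegral.sum_integral_adjacent_intervals fun N _ ↦ hcont.intervalIntegrable _ _]
    simp [ht]
  have htend : Tendsto (fun M : ℕ ↦ t M) atTop atTop :=
    Real.tendsto_log_atTop.comp (tendsto_atTop_add_const_right _ 1 tendsto_natCast_atTop_atTop)
  have hlim := MeasureTheory.intervalIntegral_tendsto_integral_Ioi 0 hint htend
  rw [hval] at hlim
  have key : HasSum (fun N : ℕ ↦ ∫ τ in t N..t (N + 1), h τ) ((k.factorial : ℝ) / u ^ (k + 1)) := by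
    rw [hasSum_iff_tendsto_nat_of_nonneg hnonneg]
    exact hlim.congr fun M ↦ (hpartial M).symm
  refine key.congr_fun fun N ↦ ?_
  rw [ht_succ]

/-! ### Step (V): the Dirichlet series `D(u) = Σ Λ(n)(log n)^k n^{−1−u}` as a real series -/

open scoped LSeries.notation ArithmeticFunction.vonMangoldt

/-- `logMul^[k] f = (log ·)^k · f`. [folklore] -/
private theorem logMul_iterate' (f : ℕ → ℂ) (k : ℕ) :
    LSeries.logMul^[k] f = fun n : ℕ ↦ (Complex.log (n : ℂ)) ^ k * f n := by
  induction k with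
  | zero => funext n; simp
  | succ k ih =>
    funext n
    rw [Function.iterate_succ_apply', ih]
    simp only [LSeries.logMul]
    ring

/-- Summability of `Σ Λ(n)(log n)^k n^{−σ}` for real `σ > 1`, and the value of the `L`-series as a real
series over `m ↦ m+1`: `Re L((log)^k Λ)(σ) = Σ_m Λ(m+1)(log(m+1))^k/(m+1) · (m+1)^{1−σ}`. [folklore] -/
private theorem re_LSeries_logPow_vonMangoldt (k : ℕ) {u : ℝ} (hu : 0 < u) :
    Summable (fun m : ℕ ↦ (Λ (m + 1) : ℝ) * Real.log ((m : ℝ) + 1) ^ k / ((m : ℝ) + 1) * ((m : ℝ) + 1) ^ (-u)) ∧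
    (LSeries (fun n ↦ (Complex.log n) ^ k * ↗Λ n) ((1 + u : ℝ) : ℂ)).re =
      ∑' m : ℕ, (Λ (m + 1) : ℝ) * Real.log ((m : ℝ) + 1) ^ k / ((m : ℝ) + 1) * ((m : ℝ) + 1) ^ (-u) := by
  set f : ℕ → ℂ := fun n ↦ (Complex.log n) ^ k * ↗Λ n with hf
  set s : ℂ := ((1 + u : ℝ) : ℂ) with hs
  set r : ℕ → ℝ := fun n ↦ (Λ n : ℝ) * Real.log (n : ℝ) ^ k / (n : ℝ) ^ (1 + u) with hr
  -- the terms are real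
  have hterm : ∀ n : ℕ, LSeries.term f s n = ((r n : ℝ) : ℂ) := by
    intro n
    rcases Nat.eq_zero_or_pos n with rfl | hn
    · simp [LSeries.term_zero, hr]
    · rw [LSeries.term_of_ne_zero hn.ne', hf, hr, hs]
      simp only
      rw [show (n : ℂ) = ((n : ℝ) : ℂ) by norm_cast, ← Complex.ofReal_cpow (Nat.cast_nonneg n),
        ← Complex.ofReal_log (Nat.cast_nonneg n)]
      push_cast
      ring
  -- summability from the abscissa of absolute convergence of `Λ`
  have habs : LSeries.abscissaOfAbsConv f < s.re := by
    have h1 : LSeries.abscissaOfAbsConv ↗Λ ≤ 1 :=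
      LSeries.abscissaOfAbsConv_le_of_forall_lt_LSeriesSummable fun y hy ↦
        ArithmeticFunction.LSeriesSummable_vonMangoldt (by simpa using hy)
    rw [hf, ← logMul_iterate', LSeries.absicssaOfAbsConv_logPowMul, hs]
    simp only [Complex.ofReal_re]
    exact lt_of_le_of_lt h1 (by exact_mod_cast (by linarith : (1 : ℝ) < 1 + u))
  have hsum : LSeriesSummable f s := LSeriesSummable_of_abscissaOfAbsConv_lt_re habs
  have hsumr : Summable r := by
    have : Summable fun n ↦ ((r n : ℝ) : ℂ) := hsum.congr hterm
    exact Complex.summable_ofReal.1 this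
  -- the shifted real series
  have hshift : ∀ m : ℕ, r (m + 1) =
      (Λ (m + 1) : ℝ) * Real.log ((m : ℝ) + 1) ^ k / ((m : ℝ) + 1) * ((m : ℝ) + 1) ^ (-u) := by
    intro m
    simp only [hr]
    have hm : (0 : ℝ) < (m : ℝ) + 1 := by positivity
    push_cast
    rw [Real.rpow_add hm, Real.rpow_one, Real.rpow_neg hm.le]
    field_simp
  refine ⟨((summable_nat_add_iff 1).2 hsumr).congr hshift, ?_⟩
  rw [LSeries, tsum_congr hterm, ← Complex.ofReal_tsum, Complex.ofReal_re, hsumr.tsum_eq_zero_add]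
  simp only [hr, Nat.cast_zero, ArithmeticFunction.map_zero, zero_mul, zero_div, zero_add]
  exact tsum_congr hshift

/-! ### Step (V): assembly — identification of the `η_k`-limit -/

/-- Reindexing `Icc 1 N` by `range N`. [folklore] -/
private theorem sum_Icc_eq_sum_range'' (g : ℕ → ℝ) (N : ℕ) :
    ∑ m ∈ Finset.Icc 1 N, g m = ∑ i ∈ Finset.range N, g (i + 1) := by
  rw [← Finset.Ico_add_one_right_eq_Icc, Finset.sum_Ico_eq_sum_range]
  simp only [Nat.add_sub_cancel, add_comm 1]

/-- `A(N) = Σ_{m<N} Λ(m+1)(log(m+1))^k/(m+1) = liEtaSeq k N + (log N)^{k+1}/(k+1)`. [folklore] -/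
private theorem partialSum_eq_liEtaSeq (k N : ℕ) :
    ∑ m ∈ Finset.range N, (Λ (m + 1) : ℝ) * Real.log ((m : ℝ) + 1) ^ k / ((m : ℝ) + 1) =
      liEtaSeq k N + Real.log N ^ (k + 1) / (k + 1) := by
  rw [liEtaSeq, sum_Icc_eq_sum_range'']
  push_cast
  ring

/-- The increments of `F(N) = (log N)^{k+1}/(k+1)` tend to `0`. [folklore] -/
private theorem tendsto_logPow_succ_sub (k : ℕ) :
    Tendsto (fun N : ℕ ↦ Real.log ((N : ℝ) + 1) ^ (k + 1) / ((k : ℝ) + 1) -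
      Real.log (N : ℝ) ^ (k + 1) / ((k : ℝ) + 1)) atTop (𝓝 0) := by
  -- `0 ≤ x^{k+1} − y^{k+1} ≤ (k+1) x^k (x − y)` for `0 ≤ y ≤ x`, with `x − y = log(1 + 1/N) ≤ 1/N`
  have hbound : Tendsto (fun N : ℕ ↦ 2 * ((Real.log ((N : ℝ) + 1) + 1) ^ k * ((N : ℝ) + 1) ^ (-(1 : ℝ))))
      atTop (𝓝 0) := by
    simpa using (tendsto_logpow_mul_rpow_neg k one_pos).const_mul 2
  refine squeeze_zero_norm' ?_ hbound
  filter_upwards [Filter.eventually_ge_atTop 1] with N hN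
  have hN1 : (1 : ℝ) ≤ N := by exact_mod_cast hN
  have hN0 : (0 : ℝ) < N := by linarith
  set x := Real.log ((N : ℝ) + 1) with hx
  set y := Real.log (N : ℝ) with hy
  have hy0 : 0 ≤ y := Real.log_nonneg hN1
  have hxy : y ≤ x := Real.log_le_log hN0 (by linarith)
  have hx0 : 0 ≤ x := hy0.trans hxy
  have hdiff : x - y ≤ 1 / N := by
    rw [hx, hy, ← Real.log_div (by linarith) hN0.ne']
    have := Real.log_le_sub_one_of_pos (x := ((N : ℝ) + 1) / N) (by positivity)
    have e : ((N : ℝ) + 1) / N - 1 = 1 / N := by field_simp; ring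
    linarith
  have hgeom : x ^ (k + 1) - y ^ (k + 1) = (∑ i ∈ Finset.range (k + 1), x ^ i * y ^ (k + 1 - 1 - i)) * (x - y) :=
    (geom_sum₂_mul x y (k + 1)).symm
  have hsum_le : ∑ i ∈ Finset.range (k + 1), x ^ i * y ^ (k + 1 - 1 - i) ≤ ((k : ℝ) + 1) * x ^ k := by
    calc ∑ i ∈ Finset.range (k + 1), x ^ i * y ^ (k + 1 - 1 - i)
        ≤ ∑ i ∈ Finset.range (k + 1), x ^ k := Finset.sum_le_sum fun i hi ↦ by
          have hi' : i ≤ k := Nat.lt_succ_iff.1 (Finset.mem_range.1 hi)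
          calc x ^ i * y ^ (k + 1 - 1 - i) ≤ x ^ i * x ^ (k + 1 - 1 - i) :=
                mul_le_mul_of_nonneg_left (pow_le_pow_left₀ hy0 hxy _) (pow_nonneg hx0 _)
            _ = x ^ k := by rw [← pow_add]; congr 1; omega
      _ = ((k : ℝ) + 1) * x ^ k := by simp [Finset.sum_const]
  have hk1 : (0 : ℝ) < (k : ℝ) + 1 := by positivity
  have hnum : 0 ≤ x ^ (k + 1) - y ^ (k + 1) := by
    rw [hgeom]; exact mul_nonneg (Finset.sum_nonneg fun i _ ↦ by positivity) (by linarith)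
  rw [Real.norm_eq_abs, ← sub_div, abs_of_nonneg (div_nonneg hnum hk1.le), div_le_iff₀ hk1]
  have h1 : x ^ (k + 1) - y ^ (k + 1) ≤ ((k : ℝ) + 1) * x ^ k * (1 / N) := by
    rw [hgeom]
    exact mul_le_mul hsum_le hdiff (by linarith) (by positivity)
  have h2 : x ^ k ≤ (x + 1) ^ k := pow_le_pow_left₀ hx0 (by linarith) k
  have h3 : 1 / (N : ℝ) ≤ 2 * ((N : ℝ) + 1) ^ (-(1 : ℝ)) := by
    rw [Real.rpow_neg (by positivity), Real.rpow_one, div_le_iff₀ hN0]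
    rw [show 2 * ((N : ℝ) + 1)⁻¹ * N = 2 * N / (N + 1) by field_simp]
    rw [le_div_iff₀ (by positivity)]
    linarith
  calc x ^ (k + 1) - y ^ (k + 1) ≤ ((k : ℝ) + 1) * x ^ k * (1 / N) := h1
    _ ≤ ((k : ℝ) + 1) * (x + 1) ^ k * (2 * ((N : ℝ) + 1) ^ (-(1 : ℝ))) :=
        mul_le_mul (mul_le_mul_of_nonneg_left h2 hk1.le) h3 (by positivity) (by positivity)
    _ = 2 * ((x + 1) ^ k * ((N : ℝ) + 1) ^ (-(1 : ℝ))) * ((k : ℝ) + 1) := by ring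

/-- **RH-FREE. The `η_k`-limit identified** (Bombieri–Lagarias Thm. 2; Coffey 2010 (5)):
`liEtaSeq k N = Σ_{m≤N} Λ(m)(log m)^k/m − (log N)^{k+1}/(k+1) → (−1)^{k+1} k!·Re q_k`, `q_k = (ζ₁'/ζ₁)^{(k)}(1)/k!`,
i.e. `η_k := ((−1)^k/k!)·lim = −Re q_k`. [cite: Coffey2010Eta, eq. (5)] -/
theorem tendsto_liEtaSeq (k : ℕ) :
    Tendsto (liEtaSeq k) atTop
      (𝓝 ((-1) ^ (k + 1) * (k.factorial : ℝ) * (Xiao2020.zetaOneLogDerivCoeff k).re)) := by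
  -- the limit exists
  obtain ⟨Lk, hG⟩ : ∃ Lk : ℝ, Tendsto (liEtaSeq k) atTop (𝓝 Lk) := by
    obtain ⟨L0, hL⟩ := tendsto_sum_vonMangoldt_log_pow_div_sub_exists k
    exact ⟨L0, hL.congr fun N ↦ by simp only [liEtaSeq]⟩
  set q : ℂ := Xiao2020.zetaOneLogDerivCoeff k with hq
  suffices hL : Lk = (-1) ^ (k + 1) * (k.factorial : ℝ) * q.re by rw [← hL]; exact hG
  -- notation
  set G : ℕ → ℝ := liEtaSeq k with hGdef
  set a : ℕ → ℝ := fun m ↦ (Λ (m + 1) : ℝ) * Real.log ((m : ℝ) + 1) ^ k / ((m : ℝ) + 1) with ha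
  set Fk : ℕ → ℝ := fun M ↦ Real.log (M : ℝ) ^ (k + 1) / ((k : ℝ) + 1) with hFk
  have ha0 : ∀ m, 0 ≤ a m := fun m ↦ by
    simp only [ha]
    exact div_nonneg (mul_nonneg ArithmeticFunction.vonMangoldt_nonneg
      (pow_nonneg (Real.log_nonneg (by have := m.cast_nonneg (α := ℝ); linarith)) _)) (by positivity)
  have hA : ∀ N, ∑ m ∈ Finset.range N, a m = G N + Fk N := fun N ↦ by
    rw [partialSum_eq_liEtaSeq]
  -- `G` is bounded
  obtain ⟨B, hB0, hB⟩ : ∃ B : ℝ, 0 ≤ B ∧ ∀ N, |G N| ≤ B := by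
    obtain ⟨b, hb⟩ : ∃ b, ∀ᶠ N in atTop, |G N| ≤ b := (hG.abs).isBoundedUnder_le
    obtain ⟨N₀, hN₀⟩ := Filter.eventually_atTop.1 hb
    refine ⟨max b (Finset.sup' (Finset.range (N₀ + 1)) ⟨0, by simp⟩ fun N ↦ |G N|), ?_, fun N ↦ ?_⟩
    · exact le_trans (abs_nonneg (G 0)) ((Finset.le_sup' (fun N ↦ |G N|) (by simp)).trans (le_max_right _ _))
    rcases le_or_gt N₀ N with h | h
    · exact (hN₀ N h).trans (le_max_left _ _)
    · exact (Finset.le_sup' (fun N ↦ |G N|) (Finset.mem_range.2 (by omega))).trans (le_max_right _ _)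
  -- growth of the partial sums
  have hgrowth : ∀ N : ℕ, ∑ m ∈ Finset.range N, a m ≤ (B + 1) * (Real.log ((N : ℝ) + 1) + 1) ^ (k + 1) := by
    intro N
    rw [hA N]
    have hl0 : 0 ≤ Real.log ((N : ℝ) + 1) := Real.log_nonneg (by have := N.cast_nonneg (α := ℝ); linarith)
    have h1 : 1 ≤ (Real.log ((N : ℝ) + 1) + 1) ^ (k + 1) := one_le_pow₀ (by linarith)
    have hlogN : Real.log (N : ℝ) ≤ Real.log ((N : ℝ) + 1) + 1 := by
      rcases Nat.eq_zero_or_pos N with rfl | hN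
      · simp
      · have := Real.log_le_log (by exact_mod_cast hN : (0 : ℝ) < N) (by linarith : (N : ℝ) ≤ N + 1)
        linarith
    have hlogN0 : 0 ≤ Real.log (N : ℝ) := Real.log_natCast_nonneg N
    have h2 : Fk N ≤ (Real.log ((N : ℝ) + 1) + 1) ^ (k + 1) := by
      simp only [hFk]
      rw [div_le_iff₀ (by positivity)]
      calc Real.log (N : ℝ) ^ (k + 1) ≤ (Real.log ((N : ℝ) + 1) + 1) ^ (k + 1) := pow_le_pow_left₀ hlogN0 hlogN _
        _ ≤ (Real.log ((N : ℝ) + 1) + 1) ^ (k + 1) * ((k : ℝ) + 1) :=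
            le_mul_of_one_le_right (by positivity) (by have := k.cast_nonneg (α := ℝ); linarith)
    have h3 : G N ≤ B := (le_abs_self _).trans (hB N)
    nlinarith
  -- the two limits along `u → 0⁺`
  have key : Tendsto (fun u : ℝ ↦ (∑' m : ℕ, a m * ((m : ℝ) + 1) ^ (-u)) - (k.factorial : ℝ) / u ^ (k + 1))
      (𝓝[>] 0) (𝓝 Lk) := by
    -- `Σ' w G(N+1) → L` and the error `Σ' w (Fk(N+2) − Fk(N+1)) → 0`
    have hII := tendsto_tsum_kernel_mul hG
    have hincr : Tendsto (fun N : ℕ ↦ Fk (N + 1) - Fk N) atTop (𝓝 0) := by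
      have := tendsto_logPow_succ_sub k
      refine this.congr fun N ↦ ?_
      simp only [hFk]; push_cast; ring_nf
    have hIIb := tendsto_tsum_kernel_mul hincr
    have hlim := hII.sub hIIb
    rw [sub_zero] at hlim
    -- `Fk` increments are bounded
    obtain ⟨B', hB'⟩ : ∃ B' : ℝ, ∀ N, |Fk (N + 1 + 1) - Fk (N + 1)| ≤ B' := by
      have h0 : Tendsto (fun N : ℕ ↦ Fk (N + 1 + 1) - Fk (N + 1)) atTop (𝓝 0) :=
        hincr.comp (tendsto_add_atTop_nat 1)
      obtain ⟨b, hb⟩ : ∃ b, ∀ᶠ N in atTop, |Fk (N + 1 + 1) - Fk (N + 1)| ≤ b := (h0.abs).isBoundedUnder_le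
      obtain ⟨N₀, hN₀⟩ := Filter.eventually_atTop.1 hb
      refine ⟨max b (Finset.sup' (Finset.range (N₀ + 1)) ⟨0, by simp⟩ fun N ↦ |Fk (N + 1 + 1) - Fk (N + 1)|),
        fun N ↦ ?_⟩
      rcases le_or_gt N₀ N with h | h
      · exact (hN₀ N h).trans (le_max_left _ _)
      · exact (Finset.le_sup' (fun N ↦ |Fk (N + 1 + 1) - Fk (N + 1)|) (Finset.mem_range.2 (by omega))).trans
          (le_max_right _ _)
    -- sandwich, for each `u > 0`
    have hsand : ∀ u : ℝ, 0 < u →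
        |(∑' m : ℕ, a m * ((m : ℝ) + 1) ^ (-u)) - (k.factorial : ℝ) / u ^ (k + 1) -
          ∑' N : ℕ, (((N : ℝ) + 1) ^ (-u) - ((N : ℝ) + 2) ^ (-u)) * G (N + 1)| ≤
        ∑' N : ℕ, (((N : ℝ) + 1) ^ (-u) - ((N : ℝ) + 2) ^ (-u)) * (Fk (N + 1 + 1) - Fk (N + 1)) := by
      intro u hu
      set w : ℕ → ℝ := fun N ↦ ((N : ℝ) + 1) ^ (-u) - ((N : ℝ) + 2) ^ (-u) with hw
      have hw0 : ∀ N, 0 ≤ w N := kernel_nonneg hu.le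
      have hwsum : HasSum w 1 := hasSum_kernel hu
      obtain ⟨hsa, -⟩ := re_LSeries_logPow_vonMangoldt k hu
      have h5 := hasSum_kernel_mul_partialSum hu ha0 hgrowth hsa
      simp only [hA] at h5
      -- pieces
      have hP := hasSum_pieces k hu
      have hPb := fun N ↦ piece_bounds k hu N
      have hFk1 : ∀ N : ℕ, Fk (N + 1) = Real.log ((N : ℝ) + 1) ^ (k + 1) / ((k : ℝ) + 1) := fun N ↦ by
        simp only [hFk]; push_cast; ring_nf
      have hFk2 : ∀ N : ℕ, Fk (N + 1 + 1) = Real.log ((N : ℝ) + 2) ^ (k + 1) / ((k : ℝ) + 1) := fun N ↦ by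
        simp only [hFk]; push_cast; ring_nf
      -- summabilities
      have hwG : Summable fun N ↦ w N * G (N + 1) := by
        refine Summable.of_norm_bounded (g := fun N ↦ B * w N) (hwsum.summable.mul_left B) fun N ↦ ?_
        rw [Real.norm_eq_abs, abs_mul, abs_of_nonneg (hw0 N), mul_comm]
        exact mul_le_mul_of_nonneg_right (hB _) (hw0 N)
      have hwF1 : Summable fun N ↦ w N * Fk (N + 1) := by
        refine Summable.of_nonneg_of_le (fun N ↦ mul_nonneg (hw0 N) ?_) (fun N ↦ ?_) hP.summable
        · rw [hFk1]; exact div_nonneg (pow_nonneg (Real.log_nonneg (by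
            have := N.cast_nonneg (α := ℝ); linarith)) _) (by positivity)
        · rw [hFk1, mul_comm]; exact (hPb N).1
      have hwΔ : Summable fun N ↦ w N * (Fk (N + 1 + 1) - Fk (N + 1)) := by
        refine Summable.of_norm_bounded (g := fun N ↦ B' * w N) (hwsum.summable.mul_left B') fun N ↦ ?_
        rw [Real.norm_eq_abs, abs_mul, abs_of_nonneg (hw0 N), mul_comm]
        exact mul_le_mul_of_nonneg_right (hB' _) (hw0 N)
      -- values
      have hD : ∑' m : ℕ, a m * ((m : ℝ) + 1) ^ (-u) = ∑' N, w N * G (N + 1) + ∑' N, w N * Fk (N + 1) := by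
        rw [← h5.tsum_eq, ← (hwG.hasSum.add hwF1.hasSum).tsum_eq]
        exact tsum_congr fun N ↦ by ring
      have hS1 : ∑' N, w N * Fk (N + 1) ≤ (k.factorial : ℝ) / u ^ (k + 1) :=
        hasSum_le (fun N ↦ by rw [hFk1, mul_comm]; exact (hPb N).1) hwF1.hasSum hP
      have hS2 : (k.factorial : ℝ) / u ^ (k + 1) ≤
          ∑' N, w N * Fk (N + 1) + ∑' N, w N * (Fk (N + 1 + 1) - Fk (N + 1)) := by
        have hsum2 : HasSum (fun N ↦ w N * Fk (N + 1 + 1))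
            (∑' N, w N * Fk (N + 1) + ∑' N, w N * (Fk (N + 1 + 1) - Fk (N + 1))) :=
          (hwF1.hasSum.add hwΔ.hasSum).congr_fun fun N ↦ by ring
        exact hasSum_le (fun N ↦ by rw [hFk2, mul_comm]; exact (hPb N).2) hP hsum2
      rw [hD]
      have e : ∑' N, w N * G (N + 1) + ∑' N, w N * Fk (N + 1) - (k.factorial : ℝ) / u ^ (k + 1) -
          ∑' N, w N * G (N + 1) = ∑' N, w N * Fk (N + 1) - (k.factorial : ℝ) / u ^ (k + 1) := by ring
      rw [e, abs_le]
      constructor <;> linarith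
    -- conclude `key`
    have hE : Tendsto (fun u : ℝ ↦ ∑' N : ℕ, (((N : ℝ) + 1) ^ (-u) - ((N : ℝ) + 2) ^ (-u)) *
        (Fk (N + 1 + 1) - Fk (N + 1))) (𝓝[>] 0) (𝓝 0) := hIIb
    have hdiff : Tendsto (fun u : ℝ ↦ (∑' m : ℕ, a m * ((m : ℝ) + 1) ^ (-u)) - (k.factorial : ℝ) / u ^ (k + 1) -
        ∑' N : ℕ, (((N : ℝ) + 1) ^ (-u) - ((N : ℝ) + 2) ^ (-u)) * G (N + 1)) (𝓝[>] 0) (𝓝 0) := by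
      refine squeeze_zero_norm' ?_ hE
      filter_upwards [self_mem_nhdsWithin] with u hu
      rw [Real.norm_eq_abs]
      exact hsand u hu
    have := hII.add hdiff
    rw [add_zero] at this
    exact this.congr fun u ↦ by ring
  -- the same limit from the analytic side
  have key2 : Tendsto (fun u : ℝ ↦ (∑' m : ℕ, a m * ((m : ℝ) + 1) ^ (-u)) - (k.factorial : ℝ) / u ^ (k + 1))
      (𝓝[>] 0) (𝓝 ((-1) ^ (k + 1) * (k.factorial : ℝ) * q.re)) := by
    have hmap : Tendsto (fun u : ℝ ↦ 1 + u) (𝓝[>] (0 : ℝ)) (𝓝[>] 1) := by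
      have hc : ContinuousWithinAt (fun u : ℝ ↦ 1 + u) (Set.Ioi 0) 0 :=
        (continuous_const.add continuous_id).continuousWithinAt
      have h := hc.tendsto_nhdsWithin (t := Set.Ioi (1 : ℝ)) (fun x hx ↦ by
          simp only [Set.mem_Ioi] at hx ⊢; linarith)
      simpa using h
    have hC := ((Complex.continuous_re.tendsto _).comp
      ((tendsto_LSeries_vonMangoldt_logPow_sub_real k).comp hmap))
    have hval : (((-1) ^ (k + 1) * (k.factorial : ℂ) * q)).re = (-1) ^ (k + 1) * (k.factorial : ℝ) * q.re := by
      rw [show ((-1 : ℂ) ^ (k + 1) * (k.factorial : ℂ)) = ((((-1 : ℝ) ^ (k + 1) * k.factorial : ℝ)) : ℂ) by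
        push_cast; ring, Complex.re_ofReal_mul]
    rw [hval] at hC
    refine hC.congr' ?_
    filter_upwards [self_mem_nhdsWithin] with u hu
    have hu : 0 < u := hu
    obtain ⟨-, hre⟩ := re_LSeries_logPow_vonMangoldt k hu
    simp only [Function.comp, Complex.sub_re]
    rw [hre]
    congr 1
    rw [show (((1 + u : ℝ) : ℂ) - 1) = ((u : ℝ) : ℂ) by push_cast; ring, ← Complex.ofReal_pow,
      ← Complex.ofReal_inv, ← Complex.ofReal_natCast, ← Complex.ofReal_mul, Complex.ofReal_re]
    rw [div_eq_mul_inv]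
  exact tendsto_nhds_unique key key2


/-- **`η_k = −Re q_k`**: the Bombieri–Lagarias / Coffey coefficient `η_k` (defined as the printed limit,
`liEta`) is minus the `k`-th Taylor coefficient of `ζ₁'/ζ₁` at `1` (Coffey's (12):
`ζ'/ζ(s) = −(s−1)^{−1} − Σ_p η_p (s−1)^p`, and `ζ₁'/ζ₁ = ζ'/ζ + 1/(s−1)`). [cite: Coffey2005LiCriterion, eqs. (11)–(12)] -/
theorem liEta_eq_neg_re_zetaOneLogDerivCoeff (k : ℕ) :
    liEta k = -(Xiao2020.zetaOneLogDerivCoeff k).re := by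
  rw [liEta, (tendsto_liEtaSeq k).limUnder_eq]
  have hk : (k.factorial : ℝ) ≠ 0 := by exact_mod_cast k.factorial_ne_zero
  have hsq : ((-1 : ℝ) ^ k) * (-1) ^ (k + 1) = -1 := by
    rw [← pow_add, show k + (k + 1) = 2 * k + 1 by ring, pow_succ, pow_mul]; norm_num
  field_simp
  linear_combination (Xiao2020.zetaOneLogDerivCoeff k).re * hsq

/-- The oscillating part in the `q`-form of `KeiperLiTrend.lean`: `λ̃_n = S₂(n) = −Σ_{m=1}^n C(n,m) η_{m−1}
= Σ_{j<n} C(n,j+1) Re q_j`. [cite: Coffey2005LiCriterion, eq. (52)] -/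
theorem liOscPart_eq_sum_zetaOneLogDerivCoeff (n : ℕ) :
    liOscPart n = ∑ j ∈ Finset.range n, (n.choose (j + 1) : ℝ) * (Xiao2020.zetaOneLogDerivCoeff j).re := by
  rw [liOscPart_eq, sum_Icc_eq_sum_range'']
  simp only [liEta_eq_neg_re_zetaOneLogDerivCoeff, Nat.add_sub_cancel, mul_neg, Finset.sum_neg_distrib,
    neg_neg]

/-- **Discharge of `Coffey2005_thm1`** (Coffey 2005 Thm. 1, eqs. (10)–(11) = Bombieri–Lagarias 1999 Thm. 2, the
ARITHMETIC FORMULA): the limits defining `η_k` exist and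
`λ_n = 1 − (n/2)(γ + ln π + 2 ln 2) + Σ_{m=2}^n (−1)^m C(n,m)(1−2^{−m})ζ(m) − Σ_{m=1}^n C(n,m) η_{m−1} = λ̄_n + λ̃_n`
for `n ≥ 1`. RH-FREE. [cite: Coffey2005LiCriterion, Thm. 1, eqs. (10)–(11)] -/
theorem Coffey2005_thm1_holds : Coffey2005_thm1 := by
  refine ⟨fun k ↦ ⟨_, tendsto_liEtaSeq k⟩, fun n hn ↦ ?_⟩
  -- the dictionary `λ_n − Σ_{j<n} C(n,j+1) Re q_j = liTrend n` (as in `LiCoefficientArithmeticFormulaProofs`)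
  have hdict : keiperLiCoeff n - ∑ j ∈ Finset.range n, (n.choose (j + 1) : ℝ) *
      (Xiao2020.zetaOneLogDerivCoeff j).re = liTrend n := by
    rw [keiperLiCoeff_sub_osc_eq_finite_sum hn, liTrend_eq, liArchPart_eq, liArchSum]
    have h : ∀ j : ℕ, (1 - 1 / (2 : ℝ) ^ j) = (1 - (2 : ℝ)⁻¹ ^ j) := fun j ↦ by rw [inv_pow, one_div]
    simp_rw [h]
    ring
  rw [liOscPart_eq_sum_zetaOneLogDerivCoeff, ← hdict]
  ring


end Literature.NumberTheory.LFunctions
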